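import Summits.CriticalPhenomena.Ising3DConformalLimit.Theses.PrimaryAtInfinity
import Summits.CriticalPhenomena.Ising3DConformalLimit.Theorems.PrecisionLaplacianMoebiusLimitOfTwoPointLawRegularOfLimitExists
import Summits.CriticalPhenomena.Ising3DConformalLimit.Theorems.EnergyNotSigmaSquaredMoebiusLimitExistsReductionCpt
import Summits.CriticalPhenomena.Ising3DConformalLimit.Theorems.MoebiusLimitExists.Negative.CompactnessContent
import Literature.Barriers.CriticalPhenomena.BootstrapLatticeBlindness
import HarnessLib

/-!
# Crux `PrimaryAtInfinity.ExistsRegularLimit` (stmt-CriticalPhenomena-5355) — birth skeleton (BC3)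

Skeleton-register seat `planner-skel-stmt-CriticalPhenomena-5355-0`, 2026-08-17 (route
`route-CriticalPhenomena-PrimaryAtInfinity`, re-audit bin REPAIRABLE).

The crux (rank 5 of the route): there are `ρ > 0` on `(0,1]` and `S : CorrFamily 3` with
`HasPointwiseScalingLimit (criticalCorr 3) ρ S`, `S = 0` off `NonCoincident`, `IsNondegenerateTwoPoint S`,
`IsTranslationInvariant S`, parity `S n (−x) = S n x` and `ContinuousOn (S n) (NonCoincident 3 n)`.
By the landed `PrecisionLaplacianMoebiusLimitOfTwoPointLaw.existsRegularLimit_iff_limitExists` the whole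
regularity package is FREE, so the crux is exactly bare existence of a non-degenerate pointwise scaling
limit of the critical `ℤ³` spin correlators (= item stmt-CriticalPhenomena-4738 `WeylWindow.LimitExists`;
Duminil-Copin, ICM 2022, §8.4 p. 29: "widely open").

## The line: EXISTENCE = COMPACTNESS + UNIQUENESS of the pinned zoom, uniqueness cut by order

Pin the renormalisation at `ρ_pin(δ) = ⟨σ₀σ_{⌊1/δ⌋e₀}⟩_{β_c}^{-1/2}` (tree: `MoebiusLimitExistsOnlyInteraction.rhoPin`)
and look at the CLUSTER POINTS of the pinned zoom (`…IsClusterPoint`: locally uniform limits off the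
diagonals along one mesh sequence, all orders at once) that are REGULAR (`…IsRegular`: normalised,
continuous off the diagonals, translation invariant). Three registered stubs, the only `sorry`s of this file:

* `stub_pinnedCompactness` — COMPACTNESS: every mesh sequence `u_k → 0⁺` has a subsequence along which the
  pinned zoom converges, for every order at once, locally uniformly off the diagonals, to a regular family.
  In tree this is PROVED under the two-point law item 0634 (`pinnedZoom_compactness_of_step (pedigreeStep
  clusterMoveIneq_cubic)`: Gaussian-pairing local bounds + mirror-pedigree equicontinuity + Arzelà–Ascoli
  `compactnessSchema`); unconditionally it CONTAINS two-point doubling on `ℤ³`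
  (`MoebiusLimitExistsNegative.twoPoint_doubling_of_stub`, open) and forces non-degeneracy of every cluster
  point (`…clusterPoint_nondeg_of_stub`, used below). Size L; the honest residue is two-point doubling at `β_c(3)`.
* `stub_twoPointClusterUnique` — UNIQUENESS AT ORDER 2: any two regular cluster points have the same two-point
  function off the diagonal (existence of the SHAPE of the critical two-point function: regular variation of
  `k ↦ ⟨σ₀σ_{ke₀}⟩` plus an angular profile; implied by 0634 via the landed `stub_pinnedTwoPoint`, much weaker
  than it). Size L; open.
* `stub_higherOrdersFromTwoPoint` — UNIQUENESS AT EVEN ORDERS `≥ 4` GIVEN ORDER 2: two regular cluster points with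
  the same two-point function agree at every even order `2m ≥ 4` off the diagonals (the interacting-CFT
  uniqueness; the tree's residue 6′ `stub_interactingUnique_ge_four` of crux 1344 is its power-law instance;
  in the free stratum `U₄ ≡ 0` it is the landed `stub_freeClusterPointWick`). Size XL; open — the hardest stub.

Orders `0` (value `1`) and odd orders (value `0`, `m*(β_c) = 0`) are free for cluster points
(`IsClusterPoint.eq_const_rd`), so the three stubs make ALL regular cluster points coincide off the diagonals;
compactness plus the subsequence principle `hasPointwiseScalingLimit_of_seq_subseq` then give convergence of
the pinned zoom along the full mesh filter `𝓝[>] 0`, non-degeneracy comes from compactness, and the landed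
`stub_regularOfLimitExists` (`LimitExists → ExistsRegularLimit`) concludes the crux BY NAME
(`ExistsRegularLimit_of`, kernel-checked, no `sorry`; `ExistsRegularLimit_of_stubs` feeds it the three stubs
verbatim). Each stub is NECESSARY for the crux (a non-degenerate limit with any `ρ` re-pins to a regular
limit of the pinned zoom, whose cluster set is then a singleton), none is the crux: compactness alone has
no uniqueness, the two uniqueness stubs are vacuous without cluster points and conditional on each other's
order. Disproof used: none exists for this crux (`ledger crux ls stmt-CriticalPhenomena-5355`: no workfiles,
2026-08-17); negatives index (11 entries): no Ising3D entry bears on existence/uniqueness of the zoom.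

References: H. Duminil-Copin, ICM 2022 §8.1 (8.1)–(8.2), §8.4 p. 29 (existence open on `ℤ³`);
A. Messager, S. Miracle-Solé, J. Stat. Phys. 17 (1977) (monotonicity, behind non-degeneracy);
J. Fröhlich, R. Israel, E. H. Lieb, B. Simon, Comm. Math. Phys. 62 (1978) §2 (mirrors, behind compactness).
-/

noncomputable section

namespace Summit.CriticalPhenomena.Ising3DConformalLimit.Cruxes.ExistsRegularLimit.Birth

open Filter Topology Set
open Literature.Probability.LatticeModels
open Literature.Barriers.CriticalPhenomena (hasPointwiseScalingLimit_of_seq_subseq)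
open Summit.CriticalPhenomena.Ising3DConformalLimit.MoebiusLimitExistsOnlyInteraction
  (rhoPin IsClusterPoint rhoPin_pos isClusterPoint_of_subseq rhoPin_pow_mul_criticalCorr_zero_rd
    rhoPin_pow_mul_criticalCorr_odd_rd)
open Summit.CriticalPhenomena.Ising3DConformalLimit.MoebiusLimitExistsNegative
  (tendsto_div_succ_nhdsGT clusterPoint_nondeg_of_stub)

/-! ## The stub statements as named propositions (verbatim copies of the stub signatures below; the skeleton
audit admits the hypotheses of `ExistsRegularLimit_of` by these short names, and `ExistsRegularLimit_of_stubs`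
kernel-checks that each is definitionally the registered signature) -/

namespace Sig

/-- Statement of `stub_pinnedCompactness` (compactness of the pinned critical zoom with regular cluster points). -/
def stub_pinnedCompactness : Prop :=
    ∀ u : ℕ → ℝ, Tendsto u atTop (𝓝[>] (0 : ℝ)) →
      ∃ (φ : ℕ → ℕ) (S : CorrFamily 3), StrictMono φ ∧ MoebiusLimitExistsOnlyInteraction.IsRegular S ∧
        ∀ n, TendstoLocallyUniformlyOn
          (fun k => rescaledCorrelator (criticalCorr 3) rhoPin n (u (φ k))) (S n) atTop
          (NonCoincident 3 n)

/-- Statement of `stub_twoPointClusterUnique` (regular cluster points share one two-point function). -/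
def stub_twoPointClusterUnique : Prop :=
    ∀ S₁ S₂ : CorrFamily 3, IsClusterPoint S₁ → IsClusterPoint S₂ →
      MoebiusLimitExistsOnlyInteraction.IsRegular S₁ → MoebiusLimitExistsOnlyInteraction.IsRegular S₂ →
      (NonCoincident 3 2).EqOn (S₁ 2) (S₂ 2)

/-- Statement of `stub_higherOrdersFromTwoPoint` (even orders `≥ 4` are determined by order 2). -/
def stub_higherOrdersFromTwoPoint : Prop :=
    ∀ S₁ S₂ : CorrFamily 3, IsClusterPoint S₁ → IsClusterPoint S₂ →
      MoebiusLimitExistsOnlyInteraction.IsRegular S₁ → MoebiusLimitExistsOnlyInteraction.IsRegular S₂ →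
      (NonCoincident 3 2).EqOn (S₁ 2) (S₂ 2) →
      ∀ m : ℕ, 2 ≤ m → (NonCoincident 3 (2 * m)).EqOn (S₁ (2 * m)) (S₂ (2 * m))

end Sig

/-! ## The registered stubs (the only `sorry`s of this file) -/

/-- **stub_pinnedCompactness** (COMPACTNESS of the pinned critical zoom with REGULAR cluster points). Along every
mesh sequence `u_k → 0⁺` some subsequence of the pinned rescaled critical correlators
`ρ_pin(u_k)ⁿ ⟨σ_{[x₁/u_k]} ⋯ σ_{[xₙ/u_k]}⟩_{β_c(3)}` converges, for every `n` at once, locally uniformly on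
`NonCoincident 3 n`, to a normalised, continuous-off-diagonals, translation-invariant family. Proved in tree
UNDER item 0634 (`pinnedZoom_compactness_of_step (pedigreeStep clusterMoveIneq_cubic)`); unconditionally it
contains two-point doubling at `β_c(3)` (`twoPoint_doubling_of_stub`), which is its open content.
[cite: DuminilCopinICM2022, §8.1 eq. (8.1)–(8.2) and §8.4 p. 29] [cite: FILS1978, §2] -/
theorem stub_pinnedCompactness :
    ∀ u : ℕ → ℝ, Tendsto u atTop (𝓝[>] (0 : ℝ)) →
      ∃ (φ : ℕ → ℕ) (S : CorrFamily 3), StrictMono φ ∧ MoebiusLimitExistsOnlyInteraction.IsRegular S ∧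
        ∀ n, TendstoLocallyUniformlyOn
          (fun k => rescaledCorrelator (criticalCorr 3) rhoPin n (u (φ k))) (S n) atTop
          (NonCoincident 3 n) := by
  sorry

/-- **stub_twoPointClusterUnique** (UNIQUENESS AT ORDER 2). Any two regular cluster points of the pinned critical
zoom have the same two-point function off the diagonal: the critical two-point function of `ℤ³` has ONE scaling
shape (`⟨σ₀σ_{[x/δ]}⟩/⟨σ₀σ_{⌊1/δ⌋e₀}⟩` converges for every `x ≠ 0`). Implied by the pure power law 0634
(`stub_pinnedTwoPoint`), strictly weaker than it (no isotropy, slowly varying factors allowed on the lattice).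
[cite: DuminilCopinICM2022, §8.1 eq. (8.1) and §8.4 p. 29] -/
theorem stub_twoPointClusterUnique :
    ∀ S₁ S₂ : CorrFamily 3, IsClusterPoint S₁ → IsClusterPoint S₂ →
      MoebiusLimitExistsOnlyInteraction.IsRegular S₁ → MoebiusLimitExistsOnlyInteraction.IsRegular S₂ →
      (NonCoincident 3 2).EqOn (S₁ 2) (S₂ 2) := by
  sorry

/-- **stub_higherOrdersFromTwoPoint** (UNIQUENESS AT EVEN ORDERS `≥ 4` GIVEN ORDER 2; the hardest stub). Two regular
cluster points of the pinned critical zoom with the same two-point function agree at every even order `2m ≥ 4`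
off the diagonals. Free stratum (`U₄ ≡ 0`): landed (`stub_freeClusterPointWick`, both are the Wick family);
interacting stratum: the tree's residue 6′ (`stub_interactingUnique_ge_four`, crux 1344) is its power-law case.
[cite: DuminilCopinICM2022, §8.4 p. 29] -/
theorem stub_higherOrdersFromTwoPoint :
    ∀ S₁ S₂ : CorrFamily 3, IsClusterPoint S₁ → IsClusterPoint S₂ →
      MoebiusLimitExistsOnlyInteraction.IsRegular S₁ → MoebiusLimitExistsOnlyInteraction.IsRegular S₂ →
      (NonCoincident 3 2).EqOn (S₁ 2) (S₂ 2) →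
      ∀ m : ℕ, 2 ≤ m → (NonCoincident 3 (2 * m)).EqOn (S₁ (2 * m)) (S₂ (2 * m)) := by
  sorry

/-! ## The composition (no `sorry`) -/

/-- **The line closes the crux.** Orders `0` and odd orders are free for cluster points (`eq_const_rd`), so
stubs 2–3 make all regular cluster points coincide off the diagonals at every order; by stub 1 and the
subsequence principle the pinned zoom converges along `𝓝[>] 0` to the regular cluster point `S₀` of the meshes
`1/(k+1)`; `S₀` is non-degenerate because compactness forbids zeros of the two-point function
(`clusterPoint_nondeg_of_stub`); `stub_regularOfLimitExists` (items 4738 ⇒ 5355, landed) concludes.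
Hypotheses = the three stub statements BY NAME (`Sig.stub_*`). [folklore] -/
theorem ExistsRegularLimit_of :
    Sig.stub_pinnedCompactness → Sig.stub_twoPointClusterUnique → Sig.stub_higherOrdersFromTwoPoint →
      Summit.CriticalPhenomena.Ising3DConformalLimit.Theses.PrimaryAtInfinity.ExistsRegularLimit := by
  intro hcpt h2 h4
  -- (1) all regular cluster points agree off the diagonals at EVERY order
  have hagree : ∀ S₁ S₂ : CorrFamily 3, IsClusterPoint S₁ → IsClusterPoint S₂ →
      MoebiusLimitExistsOnlyInteraction.IsRegular S₁ → MoebiusLimitExistsOnlyInteraction.IsRegular S₂ →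
      ∀ n, (NonCoincident 3 n).EqOn (S₁ n) (S₂ n) := by
    intro S₁ S₂ hS₁ hS₂ hr₁ hr₂ n x hx
    rcases Nat.even_or_odd n with ⟨m, hm⟩ | hodd
    · obtain rfl : n = 2 * m := by omega
      rcases Nat.lt_or_ge m 2 with hm2 | hm2
      · interval_cases m
        · exact (hS₁.eq_const_rd rhoPin_pow_mul_criticalCorr_zero_rd hx).trans
            (hS₂.eq_const_rd rhoPin_pow_mul_criticalCorr_zero_rd hx).symm
        · exact h2 S₁ S₂ hS₁ hS₂ hr₁ hr₂ hx
      · exact h4 S₁ S₂ hS₁ hS₂ hr₁ hr₂ (h2 S₁ S₂ hS₁ hS₂ hr₁ hr₂) m hm2 hx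
    · exact (hS₁.eq_const_rd (fun δ y => rhoPin_pow_mul_criticalCorr_odd_rd δ hodd y) hx).trans
        (hS₂.eq_const_rd (fun δ y => rhoPin_pow_mul_criticalCorr_odd_rd δ hodd y) hx).symm
  -- (2) one regular cluster point `S₀`, along the harmonic meshes `1/(k+1)`
  obtain ⟨φ₀, S₀, hφ₀, hreg₀, hconv₀⟩ := hcpt _ (tendsto_div_succ_nhdsGT one_pos)
  have hS₀ : IsClusterPoint S₀ := isClusterPoint_of_subseq (tendsto_div_succ_nhdsGT one_pos) hφ₀ hconv₀
  -- (3) convergence along the full mesh filter, by the subsequence principle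
  have hlim : HasPointwiseScalingLimit (criticalCorr 3) rhoPin S₀ := by
    refine hasPointwiseScalingLimit_of_seq_subseq fun n u hu => ?_
    obtain ⟨φ, S, hφ, hreg, hconv⟩ := hcpt u hu
    have hS : IsClusterPoint S := isClusterPoint_of_subseq hu hφ hconv
    exact ⟨φ, hφ, (hconv n).congr_right fun x hx => (hagree S₀ S hS₀ hS hreg₀ hreg n hx).symm⟩
  -- (4) non-degeneracy is forced by compactness; (5) the regularity package is free
  have hnd : IsNondegenerateTwoPoint S₀ := clusterPoint_nondeg_of_stub hcpt hS₀
  exact PrecisionLaplacianMoebiusLimitOfTwoPointLaw.stub_regularOfLimitExists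
    ⟨rhoPin, S₀, rhoPin_pos, hlim, hnd⟩

/-- **The registered stubs discharge the three hypotheses of `ExistsRegularLimit_of` verbatim** (no `sorry` of its
own; it depends on the stubs' `sorry`s until they land — then it IS the proof of the crux; it also kernel-checks
that each `Sig.stub_X` is definitionally the registered signature of `stub_X`). [folklore] -/
theorem ExistsRegularLimit_of_stubs :
    Summit.CriticalPhenomena.Ising3DConformalLimit.Theses.PrimaryAtInfinity.ExistsRegularLimit :=
  ExistsRegularLimit_of stub_pinnedCompactness stub_twoPointClusterUnique stub_higherOrdersFromTwoPoint

end Summit.CriticalPhenomena.Ising3DConformalLimit.Cruxes.ExistsRegularLimit.Birth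

end
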